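import Literature.Probability.Percolation.TriCoarseTiling
import Literature.Probability.Percolation.TriLatticeRounding
import HarnessLib

/-!
# The coarse tile centres in the plane

Topic `Literature/Probability/Percolation`; family `crit-perc`. The metric side of the
coarse-graining of `TriCoarseTiling.lean`: the centres of the tiles, at mesh `δ`, are the mesh
points of a copy of `𝕋` rotated and scaled by `α = 3 + 2ζ` (`‖α‖ = √19`), every site is within
`2δ` of the centre of its tile, and the coarse sites whose centres are near a continuous curve
are connected in the coarse lattice — the tool for discretising the curves of Bollobás–Riordan's
construction (*Percolation* (2006), Ch. 7 §7.2.5, e.g. Claim 18 p. 191) at the level of tiles.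

* `alphaC`, `norm_alphaC`, `triEmbed_coarseMul` (`embed (αc) = α · embed c`); `tileCentrePt δ c`
  (the centre of the tile of `c`), `coarsePt_eq`, `dist_triMeshPoint_coarsePt_le`;
* `pathIn_near_path_coarse` — coarse sites with centres within `0.7 √19 δ` of a curve are joined
  by coarse lattice paths through such sites (`pathIn_near_path` after rotating by `α/‖α‖`).

## References

* B. Bollobás, O. Riordan, *Percolation*, Cambridge University Press (2006), Ch. 7 §7.2.5
  p. 191.

## Mathlib / tree

Tree: `TriCoarseTiling.lean` (`coarseMul`, `tileCentre`), `TriLatticeRounding.lean`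
(`pathIn_near_path`, `norm_add_mul_triZeta_sq`), `OneArmLSW.lean` (`triEmbed_re/im`,
`norm_triEmbed_le_triNorm`).
-/

noncomputable section

open Literature.Probability.LatticeModels

namespace Literature.Probability.Percolation

/-- The complex number `α = 3 + 2ζ` by which the coarse lattice is multiplied. [folklore] -/
def alphaC : ℂ := 3 + 2 * triZeta

/-- `‖α‖² = 19`. [folklore] -/
theorem norm_alphaC_sq : ‖alphaC‖ ^ 2 = 19 := by
  have := norm_add_mul_triZeta_sq 3 2
  rw [alphaC]
  push_cast at this ⊢
  linarith [this]

/-- `‖α‖ = √19`. [folklore] -/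
theorem norm_alphaC : ‖alphaC‖ = Real.sqrt 19 := by
  rw [← Real.sqrt_sq (norm_nonneg alphaC), norm_alphaC_sq]

/-- `α ≠ 0`. [folklore] -/
theorem alphaC_ne_zero : alphaC ≠ 0 := by
  intro h; have := norm_alphaC_sq; rw [h, norm_zero] at this; norm_num at this

/-- **The embedding intertwines `coarseMul` with multiplication by `α`.** [folklore] -/
theorem triEmbed_coarseMul (c : Site 2) : triEmbed (coarseMul c) = alphaC * triEmbed c := by
  have hre : alphaC.re = 4 := by simp [alphaC]; norm_num
  have him : alphaC.im = Real.sqrt 3 := by simp [alphaC]; ring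
  have h3 : Real.sqrt 3 * Real.sqrt 3 = 3 := Real.mul_self_sqrt (by norm_num)
  apply Complex.ext
  · rw [triEmbed_re, Complex.mul_re, hre, him, triEmbed_re, triEmbed_im, coarseMul_zero_apply, coarseMul_one_apply]
    push_cast
    have e : Real.sqrt 3 * ((c 1 : ℝ) * (Real.sqrt 3 / 2)) = (c 1 : ℝ) * (Real.sqrt 3 * Real.sqrt 3) / 2 := by ring
    rw [e, h3]; ring
  · rw [triEmbed_im, Complex.mul_im, hre, him, triEmbed_re, triEmbed_im, coarseMul_one_apply]
    push_cast
    ring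

/-- **The centre of the tile of the coarse site `c` in the plane** at mesh `δ`. [folklore] -/
def tileCentrePt (δ : ℝ) (c : Site 2) : ℂ := triMeshPoint δ (coarseMul c)

/-- The coarse centres are the mesh points of a rotated and scaled copy of `𝕋`. [folklore] -/
theorem coarsePt_eq (δ : ℝ) (c : Site 2) : tileCentrePt δ c = (δ : ℂ) * alphaC * triEmbed c := by
  rw [tileCentrePt, triMeshPoint, triEmbed_coarseMul, mul_assoc]

/-- **Every site is within `2δ` of the centre of its tile.** [folklore] -/
theorem dist_triMeshPoint_coarsePt_le {δ : ℝ} (hδ : 0 ≤ δ) (x : Site 2) :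
    dist (triMeshPoint δ x) (tileCentrePt δ (tileCentre x)) ≤ 2 * δ := by
  rw [tileCentrePt, triMeshPoint, triMeshPoint, dist_eq_norm, ← mul_sub, ← triEmbed_sub, norm_mul, Complex.norm_real,
    Real.norm_eq_abs, abs_of_nonneg hδ]
  have h1 : ‖triEmbed (x - coarseMul (tileCentre x))‖ ≤ (triNorm (x - coarseMul (tileCentre x)) : ℝ) :=
    norm_triEmbed_le_triNorm _
  have h2 : (triNorm (x - coarseMul (tileCentre x)) : ℝ) ≤ 2 := by exact_mod_cast triNorm_sub_coarseMul_tileCentre x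
  nlinarith [norm_nonneg (triEmbed (x - coarseMul (tileCentre x)))]

/-- **Coarse sites near a curve are connected in the coarse lattice**: the coarse sites whose
tile centres are within `0.7 √19 δ` of a continuous curve are joined by coarse lattice paths
through such sites (the rounding lemma `pathIn_near_path` in the rotated and scaled lattice of
tile centres). [folklore] -/
theorem pathIn_near_path_coarse {δ : ℝ} (hδ : 0 < δ) {x y : ℂ} (γ : Path x y) {c c' : Site 2}
    (hc : ∃ t, dist (γ t) (tileCentrePt δ c) ≤ 7 / 10 * (Real.sqrt 19 * δ))
    (hc' : ∃ t, dist (γ t) (tileCentrePt δ c') ≤ 7 / 10 * (Real.sqrt 19 * δ)) :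
    PathIn triGraph {e : Site 2 | ∃ t, dist (γ t) (tileCentrePt δ e) ≤ 7 / 10 * (Real.sqrt 19 * δ)} c c' := by
  -- the unit `u = α / √19` and the rotated curve `u⁻¹ γ`
  have h19 : (0 : ℝ) < Real.sqrt 19 := Real.sqrt_pos.2 (by norm_num)
  set u : ℂ := alphaC / (Real.sqrt 19 : ℂ) with hu
  have hunorm : ‖u‖ = 1 := by
    rw [hu, norm_div, norm_alphaC, Complex.norm_real, Real.norm_eq_abs, abs_of_pos h19, div_self h19.ne']
  have hune : u ≠ 0 := fun h => by rw [h, norm_zero] at hunorm; exact zero_ne_one hunorm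
  have hkey : ∀ (z : ℂ) (e : Site 2), dist z (tileCentrePt δ e) = dist (u⁻¹ * z) (triMeshPoint (Real.sqrt 19 * δ) e) := by
    intro z e
    have e1 : tileCentrePt δ e = u * triMeshPoint (Real.sqrt 19 * δ) e := by
      rw [coarsePt_eq, triMeshPoint, hu]; push_cast
      field_simp
    rw [e1, dist_eq_norm, dist_eq_norm, show z - u * triMeshPoint (Real.sqrt 19 * δ) e =
      u * (u⁻¹ * z - triMeshPoint (Real.sqrt 19 * δ) e) by rw [mul_sub, ← mul_assoc, mul_inv_cancel₀ hune, one_mul],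
      norm_mul, hunorm, one_mul]
  set γ' : Path (u⁻¹ * x) (u⁻¹ * y) := γ.map (continuous_const_mul u⁻¹) with hγ'
  have hset : {e : Site 2 | ∃ t, dist (γ t) (tileCentrePt δ e) ≤ 7 / 10 * (Real.sqrt 19 * δ)} =
      {e : Site 2 | ∃ t, dist (γ' t) (triMeshPoint (Real.sqrt 19 * δ) e) ≤ 7 / 10 * (Real.sqrt 19 * δ)} := by
    ext e; simp only [Set.mem_setOf_eq, hγ', Path.map_coe, Function.comp_apply, hkey]
  rw [hset]
  refine pathIn_near_path (by positivity) γ' ?_ ?_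
  · obtain ⟨t, ht⟩ := hc; exact ⟨t, by simpa only [hγ', Path.map_coe, Function.comp_apply, hkey] using ht⟩
  · obtain ⟨t, ht⟩ := hc'; exact ⟨t, by simpa only [hγ', Path.map_coe, Function.comp_apply, hkey] using ht⟩

end Literature.Probability.Percolation
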